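import Summits.HodgeConjecture.HodgeConjecture.Theorems.K2LiuCartanSeriesGL2

/-!
# The `GL₂` Cartan series of the unramified doubling kernel — the closed form `S·D(A)·D′(B) = ω(1−AB)(1−qAB)`
# (LOCAL SEAM of s23, engine F3 of #28s, §3–§5)

Track B ∕ K2-LIT, hLiu418 = stmt-HodgeConjecture-24832; socket #28s `sig_K2LiuUnramifiedDoublingHeckeIdentity` (U5b ED. 3). Helper
(count-neutral, own head per LEAD R3), PURE ANALYSIS over `ℂ`, sequel of ★ `K2LiuCartanSeriesGL2` (§1 the cone decomposition
`exists_coneEquiv` of `ℕ × ℤ`). For a sequence `e` with the `GL₂` Hecke recursion `e₀ = 1, e₁ = a₁, e₂ = a₁² − (q+1)ω,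
e_{k+3} = a₁e_{k+2} − qωe_{k+1}` (★ `K2LiuGL2HeckePrimitiveSplit.heckeOperator_zpowDiagGL_apply_eq_smul`) and a SUMMABLE family

  `G(k, j) = e_k · ω^j · A^{(j+k)⁺ + j⁺} · B^{(j+k)⁻ + j⁻}`  on `ℕ × ℤ`  (the Cartan lattice `a = (j+k, j)` of `GL₂`),

* §3 `tsum_mul_quadratic_of_rec`: `(∑ f_k X^k)(1 − a₁X + cX²) = f₀ + (f₁ − a₁f₀)X + (f₂ − a₁f₁ + cf₀)X²` for any `f` with
  `f_{k+3} = a₁f_{k+2} − cf_{k+1}` (shifts only, no division);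
* §4 the three cone sums: `S₁·D(A) = 1` (`j ≥ 0`), `S₃·D′(B) = B²` (`j < −k`), `S₂·D(A)·D′(B) = B·N` (`−k ≤ j < 0`), `D(X) = 1 − a₁X + qωX²`,
  `D′(B) = ω − a₁B + qB² = ω·D(B∕ω)`;
* §5 **`tsum_cartanSeriesGL2_mul_eq`**: `(∑' G) · (1 − a₁A + qωA²) · (ω − a₁B + qB²) = ω · (1 − AB) · (1 − qAB)` — the cleared-denominator
  closed form `c_v = L(s+½, BC(σ_v) ⊗ χ_v) ∕ b_{2,v}` of #28s at `A = χ_w(ϖ)q^{−(s+1)}`, `B = χ_{w̄}(ϖ)q^{−(s+1)}`, `ω = a₂`.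

All geometric ratios (`ωA²`, `B²∕ω`) have norm `< 1` BECAUSE the family is summable (their powers are sub-families), so every division
performed is by a provably non-zero quantity; `D(A)`, `D′(B)` themselves are never inverted ([Li1992, §3 Thm. 3.1];
[GelbartPiatetskishapiroRallis1987, Part A §6]; [Liu2011, §2C (2-4)]; [Macdonald1995, Ch. V §3]). Theorems only; no `sorry`.
HONEST LABEL: HC_CM is proved only modulo the printed citations (2 remaining named inputs: hLiu418 = stmt-HodgeConjecture-24832, h413 =
stmt-HodgeConjecture-24833) until rung 0 closes; this file is unconditional and moves no counter.
-/

set_option autoImplicit false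

set_option linter.dupNamespace false

noncomputable section

namespace Summit.HodgeConjecture.HodgeConjecture.Cruxes.HLiu418.K2LiuCartanSeriesGL2Closed

open Summit.HodgeConjecture.HodgeConjecture.Cruxes.HLiu418.K2LiuCartanSeriesGL2

/-! ## §3 Generating functions of three-term recursions -/

/-- shifted summability `∑ f_{k+i} X^{k+i}`. [cite: Macdonald1995, Ch. V §3] -/
theorem summable_shift {f : ℕ → ℂ} {X : ℂ} (hs : Summable fun k => f k * X ^ k) (i : ℕ) :
    Summable fun k => f (k + i) * X ^ (k + i) :=
  (summable_nat_add_iff i).2 hs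

/-- **`(∑ f_k X^k)(1 − a₁X + cX²) = f₀ + (f₁ − a₁f₀)X + (f₂ − a₁f₁ + cf₀)X²`** for a three-term recursion
`f_{k+3} = a₁f_{k+2} − cf_{k+1}` (division-free: shifts of the absolutely convergent series only). [cite: Macdonald1995, Ch. V §3 (3.9)] -/
theorem tsum_mul_quadratic_of_rec {f : ℕ → ℂ} {a₁ c X : ℂ} (hrec : ∀ k, f (k + 3) = a₁ * f (k + 2) - c * f (k + 1))
    (hs : Summable fun k => f k * X ^ k) :
    (∑' k, f k * X ^ k) * (1 - a₁ * X + c * X ^ 2) = f 0 + (f 1 - a₁ * f 0) * X + (f 2 - a₁ * f 1 + c * f 0) * X ^ 2 := by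
  have h3 := summable_shift hs 3
  have h2 := summable_shift hs 2
  have h1 := summable_shift hs 1
  -- `T = f₀ + f₁X + f₂X² + ∑ f_{k+3}X^{k+3}`
  have hT : ∑' k, f k * X ^ k = f 0 + f 1 * X + f 2 * X ^ 2 + ∑' k, f (k + 3) * X ^ (k + 3) := by
    rw [← hs.sum_add_tsum_nat_add 3]
    simp [Finset.sum_range_succ]
  -- `T·X = f₀X + f₁X² + ∑ f_{k+2}X^{k+3}`, `T·X² = f₀X² + ∑ f_{k+1}X^{k+3}`
  have hTX : (∑' k, f k * X ^ k) * X = f 0 * X + f 1 * X ^ 2 + ∑' k, f (k + 2) * X ^ (k + 3) := by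
    rw [← tsum_mul_right]
    have e1 : (fun k => f k * X ^ k * X) = fun k => f k * X ^ (k + 1) := by funext k; ring
    rw [e1]
    have hs1 : Summable fun k => f k * X ^ (k + 1) := by
      have := hs.mul_right X; refine this.congr fun k => ?_; ring
    rw [← hs1.sum_add_tsum_nat_add 2]
    simp only [Finset.sum_range_succ, Finset.sum_range_zero, zero_add, pow_one]
  have hTX2 : (∑' k, f k * X ^ k) * X ^ 2 = f 0 * X ^ 2 + ∑' k, f (k + 1) * X ^ (k + 3) := by
    rw [← tsum_mul_right]
    have e1 : (fun k => f k * X ^ k * X ^ 2) = fun k => f k * X ^ (k + 2) := by funext k; ring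
    rw [e1]
    have hs2 : Summable fun k => f k * X ^ (k + 2) := by
      have := hs.mul_right (X ^ 2); refine this.congr fun k => ?_; ring
    rw [← hs2.sum_add_tsum_nat_add 1]
    simp only [Finset.sum_range_succ, Finset.sum_range_zero, zero_add]
  -- the tail vanishes termwise
  have htail : ∑' k, f (k + 3) * X ^ (k + 3) - a₁ * ∑' k, f (k + 2) * X ^ (k + 3) + c * ∑' k, f (k + 1) * X ^ (k + 3) = 0 := by
    have h2' : Summable fun k => f (k + 2) * X ^ (k + 3) := by
      have := h2.mul_right X; refine this.congr fun k => ?_; ring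
    have h1' : Summable fun k => f (k + 1) * X ^ (k + 3) := by
      have := h1.mul_right (X ^ 2); refine this.congr fun k => ?_; ring
    rw [← tsum_mul_left, ← tsum_mul_left, ← h3.tsum_sub (h2'.mul_left a₁), ← (h3.sub (h2'.mul_left a₁)).tsum_add (h1'.mul_left c)]
    refine (tsum_congr fun k => ?_).trans tsum_zero
    rw [hrec k]
    ring
  calc (∑' k, f k * X ^ k) * (1 - a₁ * X + c * X ^ 2)
      = (∑' k, f k * X ^ k) - a₁ * ((∑' k, f k * X ^ k) * X) + c * ((∑' k, f k * X ^ k) * X ^ 2) := by ring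
    _ = (f 0 + f 1 * X + f 2 * X ^ 2 + ∑' k, f (k + 3) * X ^ (k + 3)) - a₁ * (f 0 * X + f 1 * X ^ 2 + ∑' k, f (k + 2) * X ^ (k + 3)) +
          c * (f 0 * X ^ 2 + ∑' k, f (k + 1) * X ^ (k + 3)) := by rw [← hT, ← hTX, ← hTX2]
    _ = f 0 + (f 1 - a₁ * f 0) * X + (f 2 - a₁ * f 1 + c * f 0) * X ^ 2 +
          (∑' k, f (k + 3) * X ^ (k + 3) - a₁ * ∑' k, f (k + 2) * X ^ (k + 3) + c * ∑' k, f (k + 1) * X ^ (k + 3)) := by ring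
    _ = _ := by rw [htail, add_zero]

/-- `E(X)·D(X) = 1 − ωX²` for the `GL₂` Hecke eigenvalue sequence `e`. [cite: Macdonald1995, Ch. V §3 (3.9)] -/
theorem tsum_e_mul_quadratic {e : ℕ → ℂ} {a₁ ω q X : ℂ} (he0 : e 0 = 1) (he1 : e 1 = a₁) (he2 : e 2 = a₁ ^ 2 - (q + 1) * ω)
    (he : ∀ k, e (k + 3) = a₁ * e (k + 2) - q * ω * e (k + 1)) (hs : Summable fun k => e k * X ^ k) :
    (∑' k, e k * X ^ k) * (1 - a₁ * X + q * ω * X ^ 2) = 1 - ω * X ^ 2 := by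
  rw [tsum_mul_quadratic_of_rec he hs, he0, he1, he2]
  ring

/-- `Ẽ(X)·D(X) = a₁ − (q+1)ωX` for the shifted sequence `Ẽ = ∑ e_{i+1} X^i`. [cite: Macdonald1995, Ch. V §3 (3.9)] -/
theorem tsum_e_succ_mul_quadratic {e : ℕ → ℂ} {a₁ ω q X : ℂ} (he1 : e 1 = a₁) (he2 : e 2 = a₁ ^ 2 - (q + 1) * ω)
    (he : ∀ k, e (k + 3) = a₁ * e (k + 2) - q * ω * e (k + 1)) (hs : Summable fun i => e (i + 1) * X ^ i) :
    (∑' i, e (i + 1) * X ^ i) * (1 - a₁ * X + q * ω * X ^ 2) = a₁ - (q + 1) * ω * X := by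
  rw [tsum_mul_quadratic_of_rec (f := fun i => e (i + 1)) (fun k => he (k + 1)) hs, he1, he2, he 0, he2, he1]
  ring

/-! ## §4 The three cones -/

section Cones

variable {e : ℕ → ℂ} {a₁ ω q A B : ℂ}

/-- **cone 1** (`j ≥ 0`): `S₁ = ∑_{k,j ≥ 0} e_k ω^j A^{2j+k}` satisfies `S₁ · D(A) = 1`. [cite: Li1992, §3 Thm. 3.1] [cite: Macdonald1995, Ch. V §3] -/
theorem cone_one (he0 : e 0 = 1) (he1 : e 1 = a₁) (he2 : e 2 = a₁ ^ 2 - (q + 1) * ω)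
    (he : ∀ k, e (k + 3) = a₁ * e (k + 2) - q * ω * e (k + 1))
    (h₁ : Summable fun p : ℕ × ℕ => e p.1 * ω ^ p.2 * A ^ (2 * p.2 + p.1)) :
    (∑' p : ℕ × ℕ, e p.1 * ω ^ p.2 * A ^ (2 * p.2 + p.1)) * (1 - a₁ * A + q * ω * A ^ 2) = 1 := by
  -- the two factors
  have hE : Summable fun k => e k * A ^ k := by
    refine (h₁.comp_injective (i := fun k : ℕ => (k, (0 : ℕ))) fun a b h => (Prod.ext_iff.1 h).1).congr fun k => ?_
    show e k * ω ^ 0 * A ^ (2 * 0 + k) = e k * A ^ k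
    rw [pow_zero, mul_one, mul_zero, zero_add]
  have hg : Summable fun j : ℕ => (ω * A ^ 2) ^ j := by
    refine (h₁.comp_injective (i := fun j : ℕ => ((0 : ℕ), j)) fun a b h => (Prod.ext_iff.1 h).2).congr fun j => ?_
    show e 0 * ω ^ j * A ^ (2 * j + 0) = (ω * A ^ 2) ^ j
    rw [he0, one_mul, add_zero, mul_pow, pow_mul]
  have hlt : ‖ω * A ^ 2‖ < 1 := summable_geometric_iff_norm_lt_one.1 hg
  have hne : 1 - ω * A ^ 2 ≠ 0 := by
    intro h
    have : ‖ω * A ^ 2‖ = 1 := by rw [← sub_eq_zero.1 h, norm_one]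
    exact hlt.ne this
  have hprod : (∑' p : ℕ × ℕ, e p.1 * ω ^ p.2 * A ^ (2 * p.2 + p.1)) = (∑' k, e k * A ^ k) * ∑' j, (ω * A ^ 2) ^ j := by
    rw [hE.tsum_mul_tsum hg (h₁.congr fun p => by ring)]
    exact tsum_congr fun p => by ring
  rw [hprod, tsum_geometric_of_norm_lt_one hlt, mul_assoc, mul_comm ((1 - ω * A ^ 2)⁻¹), ← mul_assoc,
    tsum_e_mul_quadratic he0 he1 he2 he hE, mul_inv_cancel₀ hne]

/-- **cone 3** (`j < −k`): `S₃ = ∑_{k,l ≥ 0} e_k ω^{−(k+l+1)} B^{k+2l+2}` satisfies `S₃ · (ω − a₁B + qB²) = B²`.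
[cite: Li1992, §3 Thm. 3.1] [cite: Macdonald1995, Ch. V §3] -/
theorem cone_three (hω : ω ≠ 0) (hB : B ≠ 0) (he0 : e 0 = 1) (he1 : e 1 = a₁) (he2 : e 2 = a₁ ^ 2 - (q + 1) * ω)
    (he : ∀ k, e (k + 3) = a₁ * e (k + 2) - q * ω * e (k + 1))
    (h₃ : Summable fun p : ℕ × ℕ => e p.1 * (ω ^ (p.1 + p.2 + 1))⁻¹ * B ^ (p.1 + 2 * p.2 + 2)) :
    (∑' p : ℕ × ℕ, e p.1 * (ω ^ (p.1 + p.2 + 1))⁻¹ * B ^ (p.1 + 2 * p.2 + 2)) * (ω - a₁ * B + q * B ^ 2) = B ^ 2 := by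
  have hBω : B ^ 2 / ω ≠ 0 := div_ne_zero (pow_ne_zero 2 hB) hω
  -- rewrite the summand as a product `(e_k (B/ω)^k) · ((B²/ω)^{l+1})`
  have hterm : ∀ p : ℕ × ℕ, e p.1 * (ω ^ (p.1 + p.2 + 1))⁻¹ * B ^ (p.1 + 2 * p.2 + 2) = (e p.1 * (B / ω) ^ p.1) * (B ^ 2 / ω) ^ (p.2 + 1) := by
    intro p
    rw [div_pow, div_pow, ← pow_mul]
    field_simp
    ring
  have hE : Summable fun k => e k * (B / ω) ^ k := by
    have h := (h₃.comp_injective (i := fun k : ℕ => (k, (0 : ℕ))) fun a b h => (Prod.ext_iff.1 h).1)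
    have h' : Summable fun k => (e k * (B / ω) ^ k) * (B ^ 2 / ω) := h.congr fun k => by
      have hk := hterm (k, 0)
      dsimp only at hk
      show e k * (ω ^ (k + 0 + 1))⁻¹ * B ^ (k + 2 * 0 + 2) = _
      rw [hk, zero_add, pow_one]
    exact (h'.div_const (B ^ 2 / ω)).congr fun k => mul_div_cancel_right₀ _ hBω
  have hg : Summable fun l : ℕ => (B ^ 2 / ω) ^ (l + 1) := by
    have h := (h₃.comp_injective (i := fun l : ℕ => ((0 : ℕ), l)) fun a b h => (Prod.ext_iff.1 h).2)
    refine h.congr fun l => ?_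
    have hl := hterm (0, l)
    dsimp only at hl
    show e 0 * (ω ^ (0 + l + 1))⁻¹ * B ^ (0 + 2 * l + 2) = _
    rw [hl, he0, pow_zero, mul_one, one_mul]
  have hg' : Summable fun l : ℕ => (B ^ 2 / ω) ^ l := (summable_nat_add_iff 1).1 hg
  have hlt : ‖B ^ 2 / ω‖ < 1 := summable_geometric_iff_norm_lt_one.1 hg'
  have hne : 1 - B ^ 2 / ω ≠ 0 := by
    intro h
    have : ‖B ^ 2 / ω‖ = 1 := by rw [← sub_eq_zero.1 h, norm_one]
    exact hlt.ne this
  have hgsum : ∑' l : ℕ, (B ^ 2 / ω) ^ (l + 1) = (B ^ 2 / ω) * (1 - B ^ 2 / ω)⁻¹ := by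
    rw [show (fun l : ℕ => (B ^ 2 / ω) ^ (l + 1)) = fun l : ℕ => (B ^ 2 / ω) * (B ^ 2 / ω) ^ l from funext fun l => pow_succ' _ _,
      tsum_mul_left, tsum_geometric_of_norm_lt_one hlt]
  have hprod : (∑' p : ℕ × ℕ, e p.1 * (ω ^ (p.1 + p.2 + 1))⁻¹ * B ^ (p.1 + 2 * p.2 + 2)) =
      (∑' k, e k * (B / ω) ^ k) * ∑' l : ℕ, (B ^ 2 / ω) ^ (l + 1) := by
    rw [hE.tsum_mul_tsum hg (h₃.congr fun p => hterm p)]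
    exact tsum_congr fun p => hterm p
  -- `E(B/ω)·D(B/ω) = 1 − B²/ω` and `ω·D(B/ω) = ω − a₁B + qB²`
  have hED := tsum_e_mul_quadratic he0 he1 he2 he hE
  have hD : ω - a₁ * B + q * B ^ 2 = ω * (1 - a₁ * (B / ω) + q * ω * (B / ω) ^ 2) := by
    field_simp
  have hωB : 1 - ω * (B / ω) ^ 2 = 1 - B ^ 2 / ω := by
    field_simp
  rw [hprod, hgsum, hD]
  calc (∑' k, e k * (B / ω) ^ k) * (B ^ 2 / ω * (1 - B ^ 2 / ω)⁻¹) * (ω * (1 - a₁ * (B / ω) + q * ω * (B / ω) ^ 2))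
      = ((∑' k, e k * (B / ω) ^ k) * (1 - a₁ * (B / ω) + q * ω * (B / ω) ^ 2)) * (1 - B ^ 2 / ω)⁻¹ * (B ^ 2 / ω * ω) := by ring
    _ = B ^ 2 := by rw [hED, hωB, mul_inv_cancel₀ hne, one_mul, div_mul_cancel₀ _ hω]

/-- **cone 2** (`−k ≤ j < 0`): `S₂ = ∑_{i,l ≥ 0} e_{l+i+1} ω^{−(i+1)} A^l B^{i+1}` satisfies
`S₂ · D(A) · (ω − a₁B + qB²) = B · (a₁ − (q+1)B − ωA·D(B∕ω) − qωA(1 − B²∕ω))` (the cross terms of the divided difference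
`(E(A) − E(B∕ω))∕(A − B∕ω)`, computed division-free). [cite: Li1992, §3 Thm. 3.1] [cite: Macdonald1995, Ch. V §3] -/
theorem cone_two (hω : ω ≠ 0) (hB : B ≠ 0) (he0 : e 0 = 1) (he1 : e 1 = a₁) (he2 : e 2 = a₁ ^ 2 - (q + 1) * ω)
    (he : ∀ k, e (k + 3) = a₁ * e (k + 2) - q * ω * e (k + 1))
    (h₂ : Summable fun p : ℕ × ℕ => e (p.2 + p.1 + 1) * (ω ^ (p.1 + 1))⁻¹ * A ^ p.2 * B ^ (p.1 + 1)) :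
    (∑' p : ℕ × ℕ, e (p.2 + p.1 + 1) * (ω ^ (p.1 + 1))⁻¹ * A ^ p.2 * B ^ (p.1 + 1)) * (1 - a₁ * A + q * ω * A ^ 2) * (ω - a₁ * B + q * B ^ 2) =
      B * (a₁ - (q + 1) * B - ω * A * (1 - a₁ * (B / ω) + q * ω * (B / ω) ^ 2) - q * ω * A * (1 - B ^ 2 / ω)) := by
  have hBω : B / ω ≠ 0 := div_ne_zero hB hω
  -- the `Q`-family `e_{l+i+1} A^l (B/ω)^i`, indexed `(l, i)`
  set Qf : ℕ × ℕ → ℂ := fun p => e (p.1 + p.2 + 1) * A ^ p.1 * (B / ω) ^ p.2 with hQf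
  have hterm : ∀ p : ℕ × ℕ, e (p.2 + p.1 + 1) * (ω ^ (p.1 + 1))⁻¹ * A ^ p.2 * B ^ (p.1 + 1) = (B / ω) * Qf (p.2, p.1) := by
    intro p
    simp only [hQf, div_pow]
    field_simp
    ring
  have hQs : Summable Qf := by
    have h := ((Equiv.prodComm ℕ ℕ).summable_iff.2 h₂)
    have h' : Summable fun p : ℕ × ℕ => (B / ω) * Qf p := by
      refine h.congr fun p => ?_
      show e ((Equiv.prodComm ℕ ℕ p).2 + (Equiv.prodComm ℕ ℕ p).1 + 1) * (ω ^ ((Equiv.prodComm ℕ ℕ p).1 + 1))⁻¹ *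
        A ^ (Equiv.prodComm ℕ ℕ p).2 * B ^ ((Equiv.prodComm ℕ ℕ p).1 + 1) = _
      rw [hterm]; rfl
    exact (h'.div_const (B / ω)).congr fun p => mul_div_cancel_left₀ _ hBω
  have hS₂ : (∑' p : ℕ × ℕ, e (p.2 + p.1 + 1) * (ω ^ (p.1 + 1))⁻¹ * A ^ p.2 * B ^ (p.1 + 1)) = (B / ω) * ∑' p, Qf p := by
    rw [← (Equiv.prodComm ℕ ℕ).tsum_eq Qf, ← tsum_mul_left]
    exact tsum_congr fun p => hterm p
  -- rows `Ẽ_l = ∑_i e_{l+i+1} (B/ω)^i` (all from the row `l = 0` by shifting)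
  have h0 : Summable fun i => e (i + 1) * (B / ω) ^ i := by
    refine (hQs.prod_factor 0).congr fun i => ?_
    simp only [hQf, pow_zero, mul_one, zero_add]
  have hrow : ∀ l, Summable fun i => e (l + i + 1) * (B / ω) ^ i := by
    intro l
    have hsh := ((summable_nat_add_iff l).2 h0).mul_right (((B / ω) ^ l)⁻¹)
    refine hsh.congr fun i => ?_
    rw [pow_add, show i + l + 1 = l + i + 1 by ring, mul_assoc, mul_assoc, mul_inv_cancel₀ (pow_ne_zero l hBω), mul_one]
  -- `Q = ∑_l A^l Ẽ_l`
  have hQ : ∑' p, Qf p = ∑' l, A ^ l * ∑' i, e (l + i + 1) * (B / ω) ^ i := by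
    rw [hQs.tsum_prod]
    refine tsum_congr fun l => ?_
    rw [← tsum_mul_left]
    exact tsum_congr fun i => by simp only [hQf]; ring
  have hu : Summable fun l => A ^ l * ∑' i, e (l + i + 1) * (B / ω) ^ i := by
    refine hQs.prod.congr fun l => ?_
    rw [← tsum_mul_left]
    exact tsum_congr fun i => by simp only [hQf]; ring
  -- the row recursion `Ẽ_{l+2} − a₁Ẽ_{l+1} + qωẼ_l = 0`
  have hrowrec : ∀ l, ∑' i, e (l + 2 + i + 1) * (B / ω) ^ i - a₁ * ∑' i, e (l + 1 + i + 1) * (B / ω) ^ i +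
      q * ω * ∑' i, e (l + i + 1) * (B / ω) ^ i = 0 := by
    intro l
    rw [← tsum_mul_left, ← tsum_mul_left, ← (hrow (l + 2)).tsum_sub ((hrow (l + 1)).mul_left a₁),
      ← ((hrow (l + 2)).sub ((hrow (l + 1)).mul_left a₁)).tsum_add ((hrow l).mul_left (q * ω))]
    refine (tsum_congr fun i => ?_).trans tsum_zero
    rw [show l + 2 + i + 1 = (l + i) + 3 by ring, show l + 1 + i + 1 = (l + i) + 2 by ring, he (l + i)]
    ring
  -- `Q·D(A) = Ẽ_0 + A(Ẽ_1 − a₁Ẽ_0)`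
  have hQD : (∑' p, Qf p) * (1 - a₁ * A + q * ω * A ^ 2) =
      ∑' i, e (0 + i + 1) * (B / ω) ^ i + A * (∑' i, e (1 + i + 1) * (B / ω) ^ i - a₁ * ∑' i, e (0 + i + 1) * (B / ω) ^ i) := by
    rw [hQ]
    set u : ℕ → ℂ := fun l => A ^ l * ∑' i, e (l + i + 1) * (B / ω) ^ i with hudef
    have hu2 := (summable_nat_add_iff 2).2 hu
    have hu1 := (summable_nat_add_iff 1).2 hu
    have hU : ∑' l, u l = u 0 + u 1 + ∑' l, u (l + 2) := by
      rw [← hu.sum_add_tsum_nat_add 2]; simp [Finset.sum_range_succ]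
    have hUA : (∑' l, u l) * A = u 0 * A + ∑' l, u (l + 1) * A := by
      rw [← tsum_mul_right, ← (hu.mul_right A).sum_add_tsum_nat_add 1]; simp
    have hUA2 : (∑' l, u l) * A ^ 2 = ∑' l, u l * A ^ 2 := by rw [← tsum_mul_right]
    have htail : ∑' l, u (l + 2) - a₁ * ∑' l, u (l + 1) * A + q * ω * ∑' l, u l * A ^ 2 = 0 := by
      rw [← tsum_mul_left, ← tsum_mul_left, ← hu2.tsum_sub ((hu1.mul_right A).mul_left a₁),
        ← (hu2.sub ((hu1.mul_right A).mul_left a₁)).tsum_add ((hu.mul_right (A ^ 2)).mul_left (q * ω))]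
      refine (tsum_congr fun l => ?_).trans tsum_zero
      simp only [hudef]
      have := hrowrec l
      calc A ^ (l + 2) * ∑' i, e (l + 2 + i + 1) * (B / ω) ^ i - a₁ * (A ^ (l + 1) * (∑' i, e (l + 1 + i + 1) * (B / ω) ^ i) * A) +
            q * ω * (A ^ l * (∑' i, e (l + i + 1) * (B / ω) ^ i) * A ^ 2)
          = A ^ (l + 2) * (∑' i, e (l + 2 + i + 1) * (B / ω) ^ i - a₁ * ∑' i, e (l + 1 + i + 1) * (B / ω) ^ i +
              q * ω * ∑' i, e (l + i + 1) * (B / ω) ^ i) := by ring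
        _ = 0 := by rw [this, mul_zero]
    calc (∑' l, u l) * (1 - a₁ * A + q * ω * A ^ 2) = ∑' l, u l - a₁ * ((∑' l, u l) * A) + q * ω * ((∑' l, u l) * A ^ 2) := by ring
      _ = (u 0 + u 1 + ∑' l, u (l + 2)) - a₁ * (u 0 * A + ∑' l, u (l + 1) * A) + q * ω * ∑' l, u l * A ^ 2 := by
          rw [← hU, ← hUA, ← hUA2]
      _ = u 0 + u 1 - a₁ * (u 0 * A) + (∑' l, u (l + 2) - a₁ * ∑' l, u (l + 1) * A + q * ω * ∑' l, u l * A ^ 2) := by ring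
      _ = u 0 + u 1 - a₁ * (u 0 * A) := by rw [htail, add_zero]
      _ = _ := by simp only [hudef, pow_zero, one_mul, pow_one]; ring
  -- `Ẽ_1 − a₁Ẽ_0 = −ω − qω E(B/ω)` and the two generating functions
  have hE : Summable fun k => e k * (B / ω) ^ k :=
    (summable_nat_add_iff (f := fun k => e k * (B / ω) ^ k) 1).1 ((h0.mul_right (B / ω)).congr fun k => by
      show e (k + 1) * (B / ω) ^ k * (B / ω) = e (k + 1) * (B / ω) ^ (k + 1); rw [pow_succ, mul_assoc])
  have hE1 : ∑' i, e (1 + i + 1) * (B / ω) ^ i - a₁ * ∑' i, e (0 + i + 1) * (B / ω) ^ i = -ω - q * ω * ∑' k, e k * (B / ω) ^ k := by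
    -- `∑ (e_{i+2} − a₁e_{i+1})X^i = (e₂ − a₁e₁) + ∑ (e_{i+3} − a₁e_{i+2})X^{i+1} = −(q+1)ω − qω(E − 1)`
    have hs : Summable fun i => (e (i + 2) - a₁ * e (i + 1)) * (B / ω) ^ i := by
      refine ((hrow 1).sub ((hrow 0).mul_left a₁)).congr fun i => ?_
      rw [show 1 + i + 1 = i + 2 by ring, show 0 + i + 1 = i + 1 by ring]; ring
    have hlhs : ∑' i, e (1 + i + 1) * (B / ω) ^ i - a₁ * ∑' i, e (0 + i + 1) * (B / ω) ^ i =
        ∑' i, (e (i + 2) - a₁ * e (i + 1)) * (B / ω) ^ i := by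
      rw [← tsum_mul_left, ← (hrow 1).tsum_sub ((hrow 0).mul_left a₁)]
      refine tsum_congr fun i => ?_
      rw [show 1 + i + 1 = i + 2 by ring, show 0 + i + 1 = i + 1 by ring]; ring
    rw [hlhs, hs.tsum_eq_zero_add, hE.tsum_eq_zero_add]
    have htail : ∑' i, (e (i + 1 + 2) - a₁ * e (i + 1 + 1)) * (B / ω) ^ (i + 1) = -(q * ω) * ∑' k, e (k + 1) * (B / ω) ^ (k + 1) := by
      rw [← tsum_mul_left]
      refine tsum_congr fun i => ?_
      rw [show i + 1 + 2 = i + 3 by ring, show i + 1 + 1 = i + 2 by ring, he i]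
      ring
    rw [htail, he0, he1, he2]
    ring
  have hED := tsum_e_mul_quadratic he0 he1 he2 he hE
  have hE0D : (∑' i, e (0 + i + 1) * (B / ω) ^ i) * (1 - a₁ * (B / ω) + q * ω * (B / ω) ^ 2) = a₁ - (q + 1) * ω * (B / ω) := by
    have h := tsum_e_succ_mul_quadratic he1 he2 he ((hrow 0).congr fun i => by rw [zero_add])
    rw [← h]
    congr 1
    exact tsum_congr fun i => by rw [zero_add]
  have hD : ω - a₁ * B + q * B ^ 2 = ω * (1 - a₁ * (B / ω) + q * ω * (B / ω) ^ 2) := by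
    field_simp
  have hωB : 1 - ω * (B / ω) ^ 2 = 1 - B ^ 2 / ω := by
    field_simp
  -- assemble
  rw [hS₂, hD]
  set E0 := ∑' i, e (0 + i + 1) * (B / ω) ^ i with hE0def
  set E1 := ∑' i, e (1 + i + 1) * (B / ω) ^ i with hE1def
  set EE := ∑' k, e k * (B / ω) ^ k with hEEdef
  set DB := 1 - a₁ * (B / ω) + q * ω * (B / ω) ^ 2 with hDBdef
  calc B / ω * (∑' p, Qf p) * (1 - a₁ * A + q * ω * A ^ 2) * (ω * DB)
      = B * (((∑' p, Qf p) * (1 - a₁ * A + q * ω * A ^ 2)) * DB) * (ω / ω) := by ring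
    _ = B * ((E0 + A * (E1 - a₁ * E0)) * DB) := by rw [hQD, div_self hω, mul_one]
    _ = B * (E0 * DB + A * (E1 - a₁ * E0) * DB) := by ring
    _ = B * ((a₁ - (q + 1) * ω * (B / ω)) + A * (-ω - q * ω * EE) * DB) := by rw [hE0D, hE1]
    _ = B * ((a₁ - (q + 1) * ω * (B / ω)) - ω * A * DB - q * ω * A * (EE * DB)) := by ring
    _ = B * (a₁ - (q + 1) * B - ω * A * DB - q * ω * A * (1 - B ^ 2 / ω)) := by
        have hqB : (q + 1) * ω * (B / ω) = (q + 1) * B := by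
          rw [div_eq_mul_inv, show (q + 1) * ω * (B * ω⁻¹) = (q + 1) * B * (ω * ω⁻¹) by ring, mul_inv_cancel₀ hω, mul_one]
        rw [hED, hωB, hqB]

/-! ## §5 The closed form over the Cartan lattice `ℕ × ℤ` -/

/-- **THE `GL₂` CARTAN SERIES OF THE UNRAMIFIED DOUBLING KERNEL, CLOSED FORM.** For the Hecke eigenvalue sequence `e` (`e₀ = 1, e₁ = a₁,
e₂ = a₁² − (q+1)ω, e_{k+3} = a₁e_{k+2} − qωe_{k+1}`) and a SUMMABLE family `G(k, j) = e_k ω^j A^{(j+k)⁺+j⁺} B^{(j+k)⁻+j⁻}` on the Cartan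
lattice `(j+k, j)`, `k ∈ ℕ`, `j ∈ ℤ` (`ω ≠ 0`, `B ≠ 0`):
`(∑' G)·(1 − a₁A + qωA²)·(ω − a₁B + qB²) = ω(1 − AB)(1 − qAB)` — i.e. `∑' G = L(s+½, BC ⊗ χ)∕b₂` in cleared-denominator form.
[cite: Li1992, §3 Thm. 3.1] [cite: GelbartPiatetskishapiroRallis1987, Part A §6] [cite: Liu2011, §2C (2-4) p. 863] [cite: Macdonald1995, Ch. V §3] -/
theorem tsum_cartanSeriesGL2_mul_eq (hω : ω ≠ 0) (hB : B ≠ 0) (he0 : e 0 = 1) (he1 : e 1 = a₁) (he2 : e 2 = a₁ ^ 2 - (q + 1) * ω)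
    (he : ∀ k, e (k + 3) = a₁ * e (k + 2) - q * ω * e (k + 1)) {G : ℕ × ℤ → ℂ}
    (hG : ∀ (k : ℕ) (j : ℤ), G (k, j) = e k * ω ^ j * A ^ ((j + k).toNat + j.toNat) * B ^ ((-(j + k)).toNat + (-j).toNat))
    (hs : Summable G) :
    (∑' p, G p) * (1 - a₁ * A + q * ω * A ^ 2) * (ω - a₁ * B + q * B ^ 2) = ω * (1 - A * B) * (1 - q * A * B) := by
  obtain ⟨E, hE1, hE2, hE3⟩ := exists_coneEquiv
  -- the three cone families
  have h1f : ∀ p : ℕ × ℕ, G (E (Sum.inl p)) = e p.1 * ω ^ p.2 * A ^ (2 * p.2 + p.1) := by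
    intro p
    rw [hE1, hG, zpow_natCast, show ((p.2 : ℤ) + (p.1 : ℕ)).toNat + (p.2 : ℤ).toNat = 2 * p.2 + p.1 by omega,
      show (-((p.2 : ℤ) + (p.1 : ℕ))).toNat + (-(p.2 : ℤ)).toNat = 0 by omega, pow_zero, mul_one]
  have h2f : ∀ p : ℕ × ℕ, G (E (Sum.inr (Sum.inl p))) = e (p.2 + p.1 + 1) * (ω ^ (p.1 + 1))⁻¹ * A ^ p.2 * B ^ (p.1 + 1) := by
    intro p
    rw [hE2, hG, show (-((p.1 : ℤ) + 1) + ((p.2 + p.1 + 1 : ℕ) : ℤ)).toNat + (-((p.1 : ℤ) + 1)).toNat = p.2 by omega,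
      show (-(-((p.1 : ℤ) + 1) + ((p.2 + p.1 + 1 : ℕ) : ℤ))).toNat + (-(-((p.1 : ℤ) + 1))).toNat = p.1 + 1 by omega,
      show (-((p.1 : ℤ) + 1)) = -(((p.1 + 1 : ℕ) : ℤ)) by push_cast; ring, zpow_neg, zpow_natCast]
  have h3f : ∀ p : ℕ × ℕ, G (E (Sum.inr (Sum.inr p))) = e p.1 * (ω ^ (p.1 + p.2 + 1))⁻¹ * B ^ (p.1 + 2 * p.2 + 2) := by
    intro p
    rw [hE3, hG, show (-((p.1 : ℤ) + p.2 + 1) + (p.1 : ℕ)).toNat + (-((p.1 : ℤ) + p.2 + 1)).toNat = 0 by omega,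
      show (-(-((p.1 : ℤ) + p.2 + 1) + (p.1 : ℕ))).toNat + (-(-((p.1 : ℤ) + p.2 + 1))).toNat = p.1 + 2 * p.2 + 2 by omega,
      show (-((p.1 : ℤ) + p.2 + 1)) = -(((p.1 + p.2 + 1 : ℕ) : ℤ)) by push_cast; ring, zpow_neg, zpow_natCast, pow_zero, mul_one]
  -- summability of the cones and the splitting of the sum
  have hsE : Summable (G ∘ E) := E.summable_iff.2 hs
  have hs1 : Summable ((G ∘ E) ∘ Sum.inl) := hsE.comp_injective Sum.inl_injective
  have hs23 : Summable ((G ∘ E) ∘ Sum.inr) := hsE.comp_injective Sum.inr_injective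
  have hs2 : Summable (((G ∘ E) ∘ Sum.inr) ∘ Sum.inl) := hs23.comp_injective Sum.inl_injective
  have hs3 : Summable (((G ∘ E) ∘ Sum.inr) ∘ Sum.inr) := hs23.comp_injective Sum.inr_injective
  have h₁ : Summable fun p : ℕ × ℕ => e p.1 * ω ^ p.2 * A ^ (2 * p.2 + p.1) := hs1.congr fun p => h1f p
  have h₂ : Summable fun p : ℕ × ℕ => e (p.2 + p.1 + 1) * (ω ^ (p.1 + 1))⁻¹ * A ^ p.2 * B ^ (p.1 + 1) := hs2.congr fun p => h2f p
  have h₃ : Summable fun p : ℕ × ℕ => e p.1 * (ω ^ (p.1 + p.2 + 1))⁻¹ * B ^ (p.1 + 2 * p.2 + 2) := hs3.congr fun p => h3f p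
  have hsplit : ∑' p, G p = (∑' p : ℕ × ℕ, e p.1 * ω ^ p.2 * A ^ (2 * p.2 + p.1)) +
      ((∑' p : ℕ × ℕ, e (p.2 + p.1 + 1) * (ω ^ (p.1 + 1))⁻¹ * A ^ p.2 * B ^ (p.1 + 1)) +
        ∑' p : ℕ × ℕ, e p.1 * (ω ^ (p.1 + p.2 + 1))⁻¹ * B ^ (p.1 + 2 * p.2 + 2)) := by
    have e1 : ∑' c, G (E c) = ∑' i, (G ∘ E) (Sum.inl i) + ∑' i, (G ∘ E) (Sum.inr i) := hs1.tsum_sum hs23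
    have e2 : ∑' i, (G ∘ E) (Sum.inr i) = ∑' i, (G ∘ E) (Sum.inr (Sum.inl i)) + ∑' i, (G ∘ E) (Sum.inr (Sum.inr i)) :=
      hs2.tsum_sum hs3
    rw [← E.tsum_eq G, e1, e2]
    simp only [Function.comp_apply, h1f, h2f, h3f]
  -- the three cone identities
  have c1 := cone_one he0 he1 he2 he h₁
  have c2 := cone_two (A := A) hω hB he0 he1 he2 he h₂
  have c3 := cone_three hω hB he0 he1 he2 he h₃
  set S₁ := ∑' p : ℕ × ℕ, e p.1 * ω ^ p.2 * A ^ (2 * p.2 + p.1)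
  set S₂ := ∑' p : ℕ × ℕ, e (p.2 + p.1 + 1) * (ω ^ (p.1 + 1))⁻¹ * A ^ p.2 * B ^ (p.1 + 1)
  set S₃ := ∑' p : ℕ × ℕ, e p.1 * (ω ^ (p.1 + p.2 + 1))⁻¹ * B ^ (p.1 + 2 * p.2 + 2)
  rw [hsplit]
  calc (S₁ + (S₂ + S₃)) * (1 - a₁ * A + q * ω * A ^ 2) * (ω - a₁ * B + q * B ^ 2)
      = (S₁ * (1 - a₁ * A + q * ω * A ^ 2)) * (ω - a₁ * B + q * B ^ 2) +
          S₂ * (1 - a₁ * A + q * ω * A ^ 2) * (ω - a₁ * B + q * B ^ 2) +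
          (S₃ * (ω - a₁ * B + q * B ^ 2)) * (1 - a₁ * A + q * ω * A ^ 2) := by ring
    _ = 1 * (ω - a₁ * B + q * B ^ 2) +
          B * (a₁ - (q + 1) * B - ω * A * (1 - a₁ * (B / ω) + q * ω * (B / ω) ^ 2) - q * ω * A * (1 - B ^ 2 / ω)) +
          B ^ 2 * (1 - a₁ * A + q * ω * A ^ 2) := by rw [c1, c2, c3]
    _ = ω * (1 - A * B) * (1 - q * A * B) := by
        field_simp
        ring

end Cones

end Summit.HodgeConjecture.HodgeConjecture.Cruxes.HLiu418.K2LiuCartanSeriesGL2Closed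

end
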